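import Mathlib.Analysis.Normed.Unbundled.RingSeminorm
import Mathlib.Analysis.Normed.Group.Ultra
import Mathlib.NumberTheory.NumberField.Completion.FinitePlace
import Mathlib.NumberTheory.Padics.HeightOneSpectrum
import Literature.NumberTheory.EllipticCurves.NeronLocalHeight
import HarnessLib

/-!
# The `p`-adic place of `ℚ` on the completion `ℚ_v` (glue for Tate's `λ_v` on `E(ℚ) ⊂ E(ℚ_v)`)

Topic `NumberTheory/EllipticCurves` (family `abc`, G06). Pure glue lemmas, no definitions and no
named facts. The Néron local height facts of `NeronLocalHeightBadPlaces.lean` are stated for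
rational points with the `p`-adic absolute value `Rat.HeightOneSpectrum.padicAbv v` of `ℚ`
(`v : HeightOneSpectrum ℤ`, `p = natGenerator v`), while the local theory (minimal models, the
reduction map, the Tate normal form of `SplitMultiplicativeNormalForm.lean`) lives over Mathlib's
completion `K_v = v.adicCompletion ℚ` with its valuation `Valued.v` (values in `ℤᵐ⁰`) and its
ring of integers `O_v = v.adicCompletionIntegers ℚ`. This file identifies the two: Mathlib's norm
on `K_v` (`IsDedekindDomain.HeightOneSpectrum.instNormedFieldValuedAdicCompletion`, base
`Ideal.absNorm 𝔭_v = p`) is a nonarchimedean real absolute value `‖·‖` with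
`‖x‖ ≤ 1 ↔ Valued.v x ≤ 1`, `‖ι x‖ = |x|_p` for `x ∈ ℚ`, and `‖ϖ‖ = p⁻¹` for a uniformiser `ϖ`
of `O_v`; in particular (ATAEC Thm. VI.1.1(c) for Tate's series,
`WeierstrassCurve.Affine.Point.neronLocalHeight_baseChange`) `λ_p` on `E(ℚ)` is the restriction
of `λ_{‖·‖}` on `E(ℚ_v)`.

## References

* J. H. Silverman, *Advanced Topics in the Arithmetic of Elliptic Curves*, GTM 151 (1994),
  Thm. VI.1.1(c).
-/

noncomputable section

open IsDedekindDomain NumberField WithZero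

namespace Rat.HeightOneSpectrum

variable (v : HeightOneSpectrum ℤ)

/-- `𝔭_v = (p)` in `ℤ`, `p = natGenerator v` (Mathlib's `span_natGenerator` with the identity
`ℤ ≃+* ℤ`). (Extension of the Mathlib namespace `Rat.HeightOneSpectrum`.) [folklore] -/
theorem asIdeal_eq_span_natGenerator_int : v.asIdeal = Ideal.span {(natGenerator v : ℤ)} := by
  have hid : ⇑(Rat.IsIntegralClosure.intEquiv ℤ) = id := funext fun x => by simp
  have hmap : Ideal.map (Rat.IsIntegralClosure.intEquiv ℤ) v.asIdeal = v.asIdeal := by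
    rw [Ideal.map, hid, Set.image_id, Ideal.span_eq]
  rw [← hmap, ← span_natGenerator]

/-- `#(ℤ/𝔭_v) = p`. [folklore] -/
theorem absNorm_asIdeal_int : Ideal.absNorm v.asIdeal = natGenerator v := by
  rw [asIdeal_eq_span_natGenerator_int, Ideal.absNorm_span_natCast, Module.finrank_self, pow_one]

/-- `v(p) = exp(−1)`: `p` is a uniformiser of `v`. [folklore] -/
theorem valuation_natGenerator_int :
    v.valuation ℚ (natGenerator v : ℚ) = exp (-1 : ℤ) := by
  have h : v.valuation ℚ (algebraMap ℤ ℚ (natGenerator v : ℤ)) = exp (-1 : ℤ) := by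
    rw [v.valuation_of_algebraMap]
    exact v.intValuation_singleton (by exact_mod_cast (prime_natGenerator v).ne_zero)
      (asIdeal_eq_span_natGenerator_int v)
  rwa [map_natCast (algebraMap ℤ ℚ)] at h

/-- **The `v`-adic valuation of `ℚ` is the `p`-adic one**: `v(x) = exp(−ord_p x)` for `x ≠ 0`
(Mathlib proves the two valuations equivalent, `valuation_equiv_padicValuation`; both send `p`
to `exp(−1)`, hence they are equal). [folklore] -/
theorem valuation_eq_exp_neg_padicValRat {x : ℚ} (hx : x ≠ 0) :
    v.valuation ℚ x = exp (-padicValRat (natGenerator v) x) := by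
  haveI hp : Fact (natGenerator v).Prime := ⟨prime_natGenerator v⟩
  haveI hp' : Fact (Nat.Prime ((primesEquiv v : Nat.Primes) : ℕ)) := ⟨(primesEquiv v).2⟩
  have hequiv := valuation_equiv_padicValuation v
  set n : ℤ := padicValRat (natGenerator v) x with hn
  -- the `p`-adic valuation of `x` and of `p ^ n` agree
  have h2x : padicValuation (primesEquiv v) x = exp (-n) := by
    change Rat.padicValuation (natGenerator v) x = _
    simp [Rat.padicValuation, hx, hn]
  have h2p : padicValuation (primesEquiv v) ((natGenerator v : ℚ) ^ n) = exp (-n) := by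
    change Rat.padicValuation (natGenerator v) _ = _
    rw [map_zpow₀, Rat.padicValuation_self, ← exp_zsmul]
    simp
  have h1p : v.valuation ℚ ((natGenerator v : ℚ) ^ n) = exp (-n) := by
    rw [map_zpow₀, valuation_natGenerator_int, ← exp_zsmul]
    simp
  rw [← h1p]
  exact (hequiv.eq_iff).mpr (h2x.trans h2p.symm)

/-! ### The norm of `ℚ_v` -/

/-- Mathlib's norm on `ℚ_v` is a nonarchimedean absolute value. [folklore] -/
theorem isNonarchimedean_toAbsoluteValue_adicCompletion :
    IsNonarchimedean (NormedField.toAbsoluteValue (v.adicCompletion ℚ)) :=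
  fun x y => IsUltrametricDist.norm_add_le_max x y

/-- `‖x‖ ≤ 1 ↔ Valued.v x ≤ 1` on `ℚ_v` (the unit ball of the norm is `O_v`). [folklore] -/
theorem toAbsoluteValue_adicCompletion_le_one_iff (x : v.adicCompletion ℚ) :
    NormedField.toAbsoluteValue (v.adicCompletion ℚ) x ≤ 1 ↔ Valued.v x ≤ 1 := by
  change ‖x‖ ≤ 1 ↔ _
  exact Valued.toNormedField.norm_le_one_iff

/-- `‖x‖ < 1 ↔ Valued.v x < 1` on `ℚ_v`. [folklore] -/
theorem toAbsoluteValue_adicCompletion_lt_one_iff (x : v.adicCompletion ℚ) :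
    NormedField.toAbsoluteValue (v.adicCompletion ℚ) x < 1 ↔ Valued.v x < 1 := by
  change ‖x‖ < 1 ↔ _
  exact Valued.toNormedField.norm_lt_one_iff

/-- `‖x‖ = p⁻ⁿ` when `Valued.v x = exp(−n)` (Mathlib's norm on `ℚ_v` has base
`#(ℤ/𝔭_v) = p`). [folklore] -/
theorem norm_adicCompletion_of_valued_eq {x : v.adicCompletion ℚ} {n : ℤ}
    (hx : Valued.v x = exp (-n)) : ‖x‖ = (natGenerator v : ℝ) ^ (-n) := by
  rw [FinitePlace.norm_def, hx, exp_eq_coe_ofAdd, WithZeroMulInt.toNNReal_neg_apply _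
    (coe_ne_zero (a := Multiplicative.ofAdd (-n))), unzero_coe, toAdd_ofAdd, absNorm_asIdeal_int]
  push_cast
  rfl

/-- **`‖ι x‖ = |x|_p` for `x ∈ ℚ`**: Mathlib's norm on `ℚ_v` restricts along
`algebraMap ℚ ℚ_v` to the `p`-adic absolute value `Rat.HeightOneSpectrum.padicAbv v`
(normalisation `|p|_p = p⁻¹`). [folklore] -/
theorem toAbsoluteValue_adicCompletion_algebraMap (x : ℚ) :
    NormedField.toAbsoluteValue (v.adicCompletion ℚ) (algebraMap ℚ (v.adicCompletion ℚ) x) =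
      padicAbv v x := by
  haveI hp : Fact (natGenerator v).Prime := ⟨prime_natGenerator v⟩
  change ‖algebraMap ℚ (v.adicCompletion ℚ) x‖ = _
  by_cases hx : x = 0
  · subst hx
    simp
  have hval : Valued.v (algebraMap ℚ (v.adicCompletion ℚ) x) =
      exp (-padicValRat (natGenerator v) x) := by
    rw [← valuation_eq_exp_neg_padicValRat v hx]
    exact HeightOneSpectrum.valuedAdicCompletion_eq_valuation' v x
  rw [norm_adicCompletion_of_valued_eq v hval, padicAbv_apply,
    padicNorm.eq_zpow_of_nonzero hx]
  push_cast
  rfl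

/-! ### Uniformisers of `O_v` -/

/-- `O_v` is the valuation ring of `Valued.v`. [folklore] -/
theorem integers_adicCompletionIntegers_int :
    (Valued.v : Valuation (v.adicCompletion ℚ) ℤᵐ⁰).Integers (v.adicCompletionIntegers ℚ) :=
  Valuation.valuationSubring.integers _

/-- In `ℤᵐ⁰`, `x < 1` iff `x ≤ exp(−1)`. [folklore] -/
theorem le_exp_neg_one_of_lt_one {x : ℤᵐ⁰} (hx : x < 1) : x ≤ exp (-1 : ℤ) := by
  induction x using WithZero.expRecOn with
  | zero => exact zero_le
  | exp a =>
    rw [← exp_zero, exp_lt_exp] at hx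
    rw [exp_le_exp]
    omega

/-- An element of `O_v` of valuation `exp(−1)` is irreducible (a uniformiser). [folklore] -/
theorem irreducible_of_valued_eq_exp_neg_one {ϖ : v.adicCompletionIntegers ℚ}
    (h : Valued.v (ϖ : v.adicCompletion ℚ) = exp (-1 : ℤ)) : Irreducible ϖ := by
  have hv := integers_adicCompletionIntegers_int v
  have hne : exp (-1 : ℤ) ≠ (1 : ℤᵐ⁰) := by
    rw [← exp_zero, Ne, exp_inj]; decide
  refine ⟨fun hu => hne (h ▸ (hv.isUnit_iff_valuation_eq_one.mp hu)), fun a b hab => ?_⟩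
  by_contra hcon
  push Not at hcon
  have ha : Valued.v (a : v.adicCompletion ℚ) < 1 :=
    lt_of_le_of_ne (hv.map_le_one a) (fun h1 => hcon.1 (hv.isUnit_iff_valuation_eq_one.mpr h1))
  have hb : Valued.v (b : v.adicCompletion ℚ) < 1 :=
    lt_of_le_of_ne (hv.map_le_one b) (fun h1 => hcon.2 (hv.isUnit_iff_valuation_eq_one.mpr h1))
  have ha' := le_exp_neg_one_of_lt_one ha
  have hb' := le_exp_neg_one_of_lt_one hb
  have hprod : Valued.v (ϖ : v.adicCompletion ℚ) ≤ exp (-1 : ℤ) * exp (-1 : ℤ) := by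
    rw [hab, Subring.coe_mul, map_mul]
    exact mul_le_mul' ha' hb'
  rw [h, ← exp_add, exp_le_exp] at hprod
  omega

/-- `p` is a uniformiser of `O_v`: the element `p ∈ O_v` has valuation `exp(−1)`. [folklore] -/
theorem valued_natGenerator_adicCompletion :
    Valued.v (algebraMap ℚ (v.adicCompletion ℚ) (natGenerator v)) = exp (-1 : ℤ) := by
  rw [← valuation_natGenerator_int]
  exact HeightOneSpectrum.valuedAdicCompletion_eq_valuation' v _

/-- **A uniformiser of `O_v` of known norm**: there is an irreducible `ϖ ∈ O_v` with
`Valued.v ϖ = exp(−1)` and `‖ϖ‖ = p⁻¹`. [folklore] -/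
theorem exists_irreducible_norm_eq :
    ∃ ϖ : v.adicCompletionIntegers ℚ, Irreducible ϖ ∧
      Valued.v (ϖ : v.adicCompletion ℚ) = exp (-1 : ℤ) ∧
      ‖(ϖ : v.adicCompletion ℚ)‖ = (natGenerator v : ℝ)⁻¹ := by
  have hmem : algebraMap ℚ (v.adicCompletion ℚ) (natGenerator v) ∈ v.adicCompletionIntegers ℚ := by
    rw [HeightOneSpectrum.mem_adicCompletionIntegers, valued_natGenerator_adicCompletion]
    exact le_of_lt (by rw [← exp_zero, exp_lt_exp]; decide)
  refine ⟨⟨_, hmem⟩, irreducible_of_valued_eq_exp_neg_one v (valued_natGenerator_adicCompletion v),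
    valued_natGenerator_adicCompletion v, ?_⟩
  change ‖algebraMap ℚ (v.adicCompletion ℚ) (natGenerator v)‖ = _
  rw [norm_adicCompletion_of_valued_eq v (n := 1) (by
    rw [valued_natGenerator_adicCompletion]), zpow_neg, zpow_one]

/-- Every uniformiser of `O_v` has `Valued.v ϖ = exp(−1)` (all irreducibles of the discrete
valuation ring `O_v` are associated). [folklore] -/
theorem valued_eq_exp_neg_one_of_irreducible {ϖ : v.adicCompletionIntegers ℚ}
    (hϖ : Irreducible ϖ) : Valued.v (ϖ : v.adicCompletion ℚ) = exp (-1 : ℤ) := by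
  have hv := integers_adicCompletionIntegers_int v
  obtain ⟨π, hπirr, hπ, -⟩ := exists_irreducible_norm_eq v
  obtain ⟨u, hu⟩ := IsDiscreteValuationRing.associated_of_irreducible _ hπirr hϖ
  rw [← hu, Subring.coe_mul, map_mul, hπ]
  have h1 : Valued.v ((u : v.adicCompletionIntegers ℚ) : v.adicCompletion ℚ) = 1 :=
    hv.isUnit_iff_valuation_eq_one.mp u.isUnit
  rw [h1, mul_one]

/-- `‖ϖ‖ = p⁻¹` for every uniformiser `ϖ` of `O_v`. [folklore] -/
theorem norm_eq_of_irreducible {ϖ : v.adicCompletionIntegers ℚ} (hϖ : Irreducible ϖ) :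
    ‖(ϖ : v.adicCompletion ℚ)‖ = (natGenerator v : ℝ)⁻¹ := by
  rw [norm_adicCompletion_of_valued_eq v (n := 1)
    (by rw [valued_eq_exp_neg_one_of_irreducible v hϖ]), zpow_neg, zpow_one]

end Rat.HeightOneSpectrum

end
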